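import Mathlib
import HarnessLib
import HarnessLib.Audit
import Summits.SmoothPoincare4.Statement
import Literature.Geometry.Symplectic.SteinDomain
import Literature.Geometry.Symplectic.SteinBoundaryContact
import Literature.Geometry.Symplectic.PlanarContactBoundary
import Literature.AlgebraicTopology.SingularHomology.SingularChains
import Literature.Topology.FourManifolds.Handles
import Literature.Topology.FourManifolds.Gluing
import Summits.SmoothPoincare4.SmoothPoincare4.Theorems.ConvexBisectionAssemblyStructural
import Summits.SmoothPoincare4.SmoothPoincare4.Theorems.ConvexBisectionAcyclicRigidityBySectors
import Summits.SmoothPoincare4.SmoothPoincare4.Theorems.ConvexBisectionAcyclicRigidityBySectorsPA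
import HarnessLib.Audit.Status.Attr

/-!
Route: ConvexBisection

DORMANT since 2026-08-24T16:51:44Z (reconciler: no traction for 6.9 d (last activity item-evidence-added at 2026-08-17T18:24:27Z); parked, not closed — `ledger route dormant route-SmoothPoincare4-ConvexBisection --off` to reactivate) — unstaffed, not closed; items shared with open routes are served there. `ledger route dormant <id> --off` reactivates.

# Route ConvexBisection — SPC4 as rigidity of contact twisted doubles — Stein bisections of homotopy
4-spheres along a common contact seam, simplified to acyclic/planar seams, then filling rigidity

It suffices to show X = X₁ ∧ X₂ (card contact-convexity-s5-bisection). A STEIN BISECTION of a closed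
4-manifold Σ along a
common contact seam is Σ = e₁(W₁) ∪ e₂(W₂): two compact Stein domains (Wᵢ, Jᵢ) smoothly embedded,
covering Σ, meeting exactly
along their boundaries, with the two fields of complex tangencies ξ₁ = T∂W₁ ∩ J₁T∂W₁ and ξ₂ pushed
forward to the SAME plane field
on the seam Γ (this forces the twisted-double shape Σ ≅ W₁ ∪_ψ W̄₂, ψ a contactomorphism: α∧dα has
one sign). It is the
dividing-set decomposition R₊ ∪_Γ R₋ of a convex hypersurface Σ⁴ ⊂ (M⁵, ξ) (Honda–Huang) = a folded
Weinstein / folded Kähler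
structure (Breen 2023 Thm 1.5, Baykur 2006 Thm 5.1). X₁ (AcyclicBisectionExists): every homotopy
4-sphere admits a Stein bisection
whose halves are rationally acyclic (⇔ Γ is a connected ℚ-homology 3-sphere) — the output of the
card's step B1 "planarise Γ by
bypasses inside the tight S⁵" via Etnyre's planar-filling theorem + Mayer–Vietoris. X₂
(AcyclicBisectionRigidity): a homotopy
4-sphere with such a bisection is diffeomorphic to S⁴ — the card's B2, whose Wendl-attackable core
(planar Γ: both halves are
planar Lefschetz fibrations, Σ = X_F₊ ∪ X̄_F₋ for two positive factorisations of ONE planar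
monodromy) is filed as crux
PlanarBisectionRigidity (informal until `PlanarContactBoundary` is defined) and whose cork sector is
crux ContractibleTwistedDoubleStandard.
Lean: `AcyclicBisectionExists ∧ AcyclicBisectionRigidity`

## Assembly
Pure logic plus two PROVED packaging facts: from X₁ and X₂ every `HomotopySphere 4` is diffeomorphic
to the round S⁴, and
`Literature.SPC4.smoothPoincare4_of_forall_homotopySphere` (Theorems/PICReduction.lean) with
`compactSpace_of_homotopyEquiv_sphere_four_holds` and
`isOrientable_of_homotopyEquiv_sphere_four_holds` gives `SmoothPoincare4`.
The term `theorem assembly_proof : Assembly` compiles in the planner's Sk/Sketch.lean (rc 0,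
2026-08-15) — provable now.

Rationale: WHY THIS LINE. Every positive SPC4 route in the ledger manipulates handles, metrics or one
symplectic form; this one reads a homotopy 4-sphere as a
PAIR OF STEIN FILLINGS OF ONE CONTACT 3-MANIFOLD glued by a contactomorphism — the object that
convex hypersurface theory attaches to
Σ⁴ ⊂ (S⁵, ξ_std) (Honda–Huang arXiv:1907.06025 Thm 1.1 genericity, Prop 2 Weinstein R±, Thm 1.2
bypass decomposition of isotopies;
Breen arXiv:2311.16058 Thm 1.5/1.6; Baykur arXiv:math/0601396 Thm 5.1 in dimension 4) — so that
3-dimensional contact topology and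
4-dimensional filling rigidity (Eliashberg1990 Thm 5.1: fillings of S³ are B⁴; Wendl arXiv:0806.3193
Thm 1: fillings of a planar
(Γ,ξ) are Lefschetz fibrations over ANY given planar open book; Etnyre arXiv:math/0404267 Thm 4.1:
they are negative definite with
b₂⁰ = 0 and connected boundary; Plamenevskaya–Van Horn-Morris arXiv:0912.1916, Kaloti
arXiv:1311.0208: factorisation finiteness)
become standardness theorems for strata of homotopy spheres. Imported areas: higher-dimensional
contact topology (convexity,
bypasses = the move set and the source of bisections), holomorphic-curve filling rigidity, planar
mapping class group combinatorics.
Versus route SymplecticCap (crux SteinSplitV2 = Stein|Stein ALONG S³, no move set, no intermediate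
class): here the seam carries a
common contact structure, the intermediate class "ℚ-acyclic halves / planar seam" is strictly larger
than {S³} yet rigid enough to
attack (it contains the planar Stein corks: Ukida arXiv:1406.5865, Karakurt–Oba–Ukida
arXiv:1607.07661 Prop 2.3, Oba arXiv:1405.3751,
so the card's step B1 does NOT collapse to Γ = S³ — answering the novelty audit's flag (3)), and the
rigidity half is a statement about
contact twisted doubles that no prior route states. Negatives index: empty at filing.

RANKED CRUXES. #2 AcyclicBisectionRigidity (crux) — for every homotopy 4-sphere Σ: if Σ admits a
Stein bisection along a common contact seam (two compact Stein domains (W₁,J₁), (W₂,J₂) smoothly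
embedded, ranges covering Σ and meeting exactly in the images of their boundaries, pushed-forward
complex tangencies equal at every seam point) whose halves are rationally acyclic (H_k(Wᵢ;ℚ) = 0 for
k > 0; ⇔ seam a connected ℚHS³, forced by planarity via Etnyre + Mayer–Vietoris), then Σ ≅ S⁴. Card
item B2 with "planar" weakened to its homological consequence; sub-sectors: seam S³ (support
SphereSeamStandard, known), contractible halves (crux 4), planar seam (crux PlanarBisectionRigidity,
Wendl ⇒ pairs of positive factorisations of one planar monodromy), finite-π₁ halves (census:
lens-space and lens-sum seams are already excluded by H₁(Γ) ≅ H₁(W₁) ⊕ H₁(W₂) with |H₁(Wᵢ)|² =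
|H₁(Γ)| and Lisca/Etnyre–Roy arXiv:2006.16687). [difficulty: open-problem] (why it might fail: Fails
only via an exotic S⁴, but may be SPC4-hard: no classification of ℚ-acyclic Stein fillings or of
Cont(Γ,ξ) beyond lens spaces; even τ = id (doubles D(C) of contractible Stein 2-handlebodies) is
AC-adjacent, and cork twists by contactomorphisms (Gompf 1603.05090 Q2.2, open) sit inside it.)
[arXiv:1603.05090, arXiv:1607.07661, arXiv:0806.3193, arXiv:math/0404267, arXiv:2006.16687,
Eliashberg1990, AkbulutMatveyev1998]
#3 AcyclicBisectionExists (crux) — every homotopy 4-sphere Σ admits a Stein bisection along a common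
contact seam whose two halves are rationally acyclic (equivalently, by Mayer–Vietoris in the
homology sphere Σ, whose seam Γ is a connected rational homology 3-sphere). Card item B1's output:
intended proof = embed Σ ⊂ (S⁵, ξ_std) = ∂B⁶ ⊃ D(V⁵) (Σ = ∂V, V contractible, Kervaire–Milnor), make
it convex (Honda–Huang Thm 1.1, R± Weinstein by Prop 2, Stein by Cieliebak–Eliashberg/Gompf in
dimension 4), then lower (genus of a supporting open book of Γ, b₁(Γ), #π₀Γ) by bypasses realised
inside S⁵ (Thm 1.2) until Γ is planar and connected; Etnyre Thm 4.1 + vanishing intersection forms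
Q(Wᵢ) ≡ 0 (codimension-0 pieces of a homology sphere) then give b₂(Wᵢ) = 0 and the χ-count gives b₁
= b₃ = 0. Trivially true for S⁴ (B⁴ ∪ B̄⁴, Γ = S³; also D(C) for every Stein cork C). [difficulty:
open-problem] (why it might fail: Honda–Huang 1907.06025 p.4: no technology yet to simplify dividing
sets in dimension 5; an exotic Σ might force b₁(Γ) > 0 or disconnected Γ in every convex position /
folded Weinstein structure — an obstruction nobody can currently compute (nor realise the
simplification).) [arXiv:1907.06025, arXiv:1803.09142, arXiv:2311.16058, arXiv:math/0601396,
arXiv:math/0404267, KervaireMilnor1963, CieliebakEliashberg2012]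
#4 ContractibleTwistedDoubleStandard (crux) — the cork sector of crux 2, stated without homotopy
spheres: if a closed (compact, Hausdorff, second countable) smooth 4-manifold X is a Stein bisection
along a common contact seam of two compact CONTRACTIBLE Stein domains (W₁,J₁), (W₂,J₂), then X ≅ S⁴.
Such X is automatically a homotopy sphere (van Kampen + Mayer–Vietoris); examples realised in S⁴:
D(C) = C ∪_id C̄ for every Stein cork C (Mazur: C × I = B⁵), in particular with the PLANAR Stein
structure of the Akbulut cork (Ukida; Karakurt–Oba–Ukida Prop 2.3: page = disc with n+3 holes,
monodromy t_a t_b t_c t_d1 ⋯ t_dn). The content: a contactomorphism ψ : (∂W₁,ξ₁) → (∂W₂,ξ₂) between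
boundaries of contractible Stein fillings glues to S⁴ — cork twists compatible with the Stein
contact structures do not produce exotica. First test family: W₁ = W₂ = Akbulut cork with KOU's
structures J₁ (Legendrian handlebody) / J₂ (planar PALF), ψ ∈ {id, cork involution τ} whenever τ^*ξ
is isotopic to ξ. [deps: AcyclicBisectionRigidity] [difficulty: XL] (why it might fail: Gompf
1603.05090 Q2.2 (is iterated cork twisting in S⁴ standard?) is open even smoothly; already τ = id
asks D(C) ≅ S⁴ for every contractible Stein 2-handlebody C (Andrews–Curtis-adjacent); a cork (C,τ)
with τ a contactomorphism of ξ_C and C ∪_τ C̄ exotic kills it (and SPC4).) [arXiv:1603.05090,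
arXiv:1607.07661, arXiv:1406.5865, arXiv:1603.07710, Akbulut1991Fake, AkbulutMatveyev1998]
#9 SteinBisectionExists (support) — every homotopy 4-sphere admits a Stein bisection along a common
contact seam (no acyclicity). KNOWN modulo vendoring: Baykur 2006 Thm 5.1 (every closed oriented
smooth 4-manifold is X₊ ∪ X₋ with X₊, −X₋ Stein inducing isotopic contact structures on the fold,
with matching PALF open books) = Breen 2023 Thm 1.6 (folded Weinstein structures exist) =
Honda–Huang Thm 1.1 + Prop 2 applied to Σ ⊂ S⁵; plus Gray stability to make the plane fields agree
pointwise and `SteinStructure` packaging (regular maximal level set). The arena of cruxes 2–3 is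
therefore never empty; provers vendor Baykur Thm 5.1 as a named fact and discharge this item from
it. [difficulty: L] [arXiv:math/0601396, arXiv:2311.16058, arXiv:1907.06025, Gompf1998]
#9 SphereSeamStandard (support) — the Γ = S³ endpoint (degenerate planar case, disc pages): a
homotopy 4-sphere with a Stein bisection along a common contact seam homeomorphic to S³ is
diffeomorphic to S⁴ — seam S³ ⇒ ξ tight ⇒ standard (Eliashberg1992) ⇒ both halves are Stein fillings
of (S³,ξ_std) ⇒ B⁴ (Eliashberg1990 Thm 5.1; in tree the Gromov–McDuff twisted-sphere facts of
Literature.Geometry.Symplectic) ⇒ twisted sphere ⇒ S⁴ (Cerf Γ₄ = 0,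
Literature.Topology.FourManifolds.cerf_twistedSphere_four). Shares its mathematics with route
SymplecticCap's assembly for SteinSplitV2 (there: no contact-matching hypothesis, which for S³ is
automatic); known modulo named facts. [difficulty: M] [Eliashberg1990, Eliashberg1992,
CerfDiffeoSphere1968, AkbulutMatveyev1998]

TWO-LAYER PLAN. Foreseen glued splits (k ≤ 3, depth 1), filed only after a crux moves:
AcyclicBisectionRigidity ⇐ (R-a: contractible halves —
glue `ContractibleTwistedDoubleStandard → R-a` is one line) → (R-b: halves with finite nontrivial π₁
cannot occur in a homotopy-sphere
bisection: census of ℚHS contact 3-manifolds with two Stein ℚ-acyclic fillings having transverse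
H₁-kernels and trivial π₁-pushout;
lens spaces and their sums already excluded) → R. AcyclicBisectionExists ⇐ (E-a =
SteinBisectionExists, known) → (E-b: MONOTONE
SIMPLIFICATION — any Stein bisection of a homotopy sphere can be changed, through bisections of the
same Σ [bypasses inside S⁵], to one
with connected planar seam) → (E-c: planar seam ⇒ acyclic halves, Etnyre + MV, known) → E.
PlanarBisectionRigidity ⇐ (P-a: Wendl
normal form Σ ≅ X_F₊ ∪_id X̄_F₋ for positive factorisations F± of one planar monodromy, known modulo
the symmetry-of-open-book
bookkeeping flagged by the novelty audit) → (P-b: homotopy-sphere planar twisted doubles are S⁴ —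
pure planar-MCG/Kirby statement;
Hurwitz-equivalent F± give D(X_F)) → P.

KILL CRITERIA. Every filed statement is implied by SPC4 (S⁴ = B⁴ ∪ B̄⁴ has the trivial bisection),
so an outright refutation of cruxes 2–4 is an
exotic S⁴ and closes every positive route (close refuted:<Decl>). Soft kills / pivots: (i) if the
census behind R-b shows that the
ONLY ℚ-acyclic common-contact bisections of homotopy spheres have seam S³ (i.e. X₁ ⇔ SteinSplitV2 of
route SymplecticCap), close
`superseded --by route-SmoothPoincare4-SymplecticCap` and hand the contact-matching lemma over as
support there; (ii) if the
definition request `PlanarContactBoundary` is judged untypable within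
Literature/Geometry/Symplectic, keep the acyclic spine and drop
the planar items; (iii) if two tenure rounds produce no movement on crux 4's first test family
(Akbulut cork, KOU structures), mark
the route dormant — the calculus is then not yet usable, exactly Honda–Huang's caveat.

NOT DECOMPOSED YET. The S⁵-specific layer (convex embedding in (S⁵, ξ_std), dividing set, bypass
datum, the complexity c(Σ) = min (support genus, b₁, #π₀)
of dividing sets over convex positions, tightness constraints à la Giroux's criterion one dimension
up) — no contact-5-manifold
vocabulary in Literature yet and nothing is filed over it; it is the intended ENGINE of E-b, not a
statement. The Wendl normal form
and the planar-MCG statement P-b (need open books, planar mapping class groups, X_F). The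
Liouville-vs-Weinstein question for R±
(HH Assumption 1; irrelevant in dimension 4 once Stein structures are demanded, as here).
Orientation bookkeeping (forced by the
plane-field equality, see Thesis). The toy bypass path for the round S⁴ from Γ = #2 S¹×S² back to S³
(carry-over from the merged card
convex-hypersurface-s5) — a grounder exercise, not an item.

CHEAPEST FALSIFIER. (1) Census, by hand/Kirby calculus: take the Akbulut cork W¹ with KOU's two
Stein structures (J₁ Legendrian picture, J₂ Ukida's planar
PALF) and the cork involution τ; decide whether τ^*ξ₂ ≅ ξ₂ or τ^*ξ₁ ≅ ξ₂ up to isotopy (contact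
invariants: π(c⁺(ξ₁)) ≠ 0 = π(c⁺(ξ₂)),
KOU Thm 1.2; Akbulut–Karakurt for the action of τ on HF) and whether W¹ ∪_τ W̄¹ ≅ S⁴ (expected yes
for symmetric-link corks). If some
contactomorphic regluing of a planar cork pair is NOT known to be standard, that is crux 4's first
genuine instance; if all are doubles,
crux 4 starts at Gompf's Q2.2 family C(r,s;m). (2) Lookup: do Oba arXiv:1405.3751 / Etnyre–Tosun
arXiv:2004.07405 / Mark–Tosun
arXiv:1603.07710 already pin the list of planar (Γ,ξ) with contractible Stein fillings so tightly
that R-b is a finite check?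
(3) For crux 3 nothing cheap exists — that is the honest engine gap (HH p.4).

NUMBERS. Planar Lefschetz filling with page P_k (k boundary circles) and n vanishing cycles: χ = 2 −
k + n, so a ℚ-acyclic planar half has
n = k − 1 twists spanning H₁(P_k;ℚ) (B⁴: k = 1, n = 0; B⁴ again: k = 2, n = 1; rational ball B(2,1):
k = 4, n = 3 via the lantern
relation; Akbulut cork: k = 5, n = 4, Ukida). Homotopy-sphere bisection bookkeeping: H_j(Γ) ≅
H_j(W₁) ⊕ H_j(W₂) (j = 1, 2),
|H₁(Γ)| = |H₁(W₁)|·|H₁(W₂)| with |H₁(Wᵢ)|² = |H₁(Γ)|, χ(W₁) + χ(W₂) = 2. Items at open: 6 typed (3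
crux, 2 support, 1 assembly) + 2
informal to be filed (crux PlanarBisectionRigidity rank 5, support PlanarBisectionExists) + 1
definition request.

DEFINITION REQUESTS. `PlanarContactBoundary` (topic Literature/Geometry/Symplectic): for a compact
4-manifold W with `SteinStructure J`, the contact
structure `contactPlane J.J` on ∂W (via a `BoundaryData (𝓡∂ 4) W (𝓡 3)` carrier) is supported by an
open book decomposition of ∂W
whose pages have genus zero (binding = transverse link, fibration of the complement over S¹ with dα
> 0 on pages, α > 0 on the
binding; genus 0 = pages embed in ℝ²). Needed to type PlanarBisectionRigidity /
PlanarBisectionExists. Cite facts wanted later (not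
now): Baykur2006 Thm 5.1, Wendl2010 Thm 1, Etnyre2004 Thm 4.1, HondaHuang2019 Thm 1.1/1.2/Prop 2.

Novelty: Searches (2026-08-15; local searchd down, OpenAlex/S2/arXiv APIs rate-limited, zbMATH live): `lit
search --source zbmath` for
"folded Lefschetz fibration" (3: Baykur math/0601396, Cavalcanti 1303.6420, Breen 2311.16058),
"folded symplectic 4-manifold Stein
fold contact" (0), "achiral Lefschetz fibration 4-sphere twisted double positive factorization" (0),
"Kahler decomposition of
4-manifolds Baykur" (1), Wendl/Etnyre/KOU/Gompf/PVHM/Kaloti/OSS/Oba/Ukida/Mark–Tosun/Etnyre–Tosun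
title queries (ids above);
`lit frontier SmoothPoincare4 --since 2022` (30 rows: GPRC/trisection/census papers, no
convex-hypersurface or folded-symplectic paper
cites the SPC4 roots); `lit read` + grep of arXiv:1907.06025 (Thm 1.1, 1.2, Prop 2, p.4 caveat),
math/0601396 (Thm 5.1), 2311.16058
(Thms 1.5, 1.6, 1.8), 0806.3193 (Thm 1, Cor 1–3), math/0404267 (Thm 4.1), 1607.07661 (Thm 1.2, Prop
2.3), 1603.05090 (Q2.2);
ledger: 9 SPC4 routes read (nearest SymplecticCap), negatives 0, 129 cards (sibling
convex-hypersurface-s5 merged into this card).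
Nearest prior art found: Baykur arXiv:math/0601396 Thm 5.1 and Breen arXiv:2311.16058 Thm 1.5–1.8
(the OBJECT — common-contact Stein
bisections / folded Weinstein Lefschetz fibrations — exists on every closed oriented 4-manifold and
equals abstract convexity);
Honda–Huang arXiv:1907.06025 (genericity + bypasses in S⁵, never aimed at 4-manifold topology: grep
exotic|Poincaré|S^4 → nil, per the
novelty audit); KOU arXiv:1607.07661 / Ukida arXiv:1406.5865 (planar Stei  [refs: 1907.06025, math/0601396, 2311.16058, 1607.07661, 1406.5865, 1603.05090]

Barriers (technique_class: contact-convexity, stein-bisection, planar-filling-rigidity): - technique_class: contact-convexity, stein-bisection, planar-filling-rigidity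
- Literature.Barriers.SmoothPoincare4.TwistedSphereBarrierFour: used positively only at the endpoint
(seam S³ ⇒ B⁴ ∪ B̄⁴ ⇒ Cerf); nothing exotic is sought among twisted spheres.
- Literature.Barriers.SmoothPoincare4.RelativeContractibleBarrierFour: evaded — crux 4 never extends
the gluing contactomorphism ψ over a contractible half (corks show it need not extend); it
recognises the GLUED closed manifold, and the bet is precisely that Stein-compatible regluings (ψ a
contactomorphism of the induced structures) stay standard although smooth regluings of corks change
smooth structures of larger manifolds.
- Literature.Barriers.SmoothPoincare4.ContractibleBarrierFour: evaded — no step infers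
diffeomorphism of the halves from their homeomorphism type; exotic contractible Stein pairs
(Akbulut–Ruberman, Akbulut–Yasui) are ALLOWED as (W₁, W₂); only the union is claimed standard.
- Literature.Barriers.SmoothPoincare4.HCobordismBarrierFour: not invoked; diffeomorphisms come from
filling classification (Eliashberg, Wendl) and Lefschetz-fibration/handle isomorphisms, never from
an h-cobordism.
- Literature.Barriers.SmoothPoincare4.PropertyTwoRBarrier: the Legendrian 2-handle diagrams of the
halves are never slid to unlinks; positivity of factorisations / filling rigidity replaces slide
calculus; Andrews–Curtis enters only through the doubles sub-case D(C) of crux 4, where it is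
sufficient, not necessary (5-dime

Novelty grade: new-combination — route-review grade (refuter). Object (common-contact Stein bisection = abstract convexity = folded Weinstein) is KNOWN to exist on every closed oriented 4-manifold (Baykur 2006, Breen 2023) — so SteinBisectionExists is literature; the route's delta is to ask which such structures a HOMOTOPY 4-SPHERE (refuter refuter-rreview-route-Parity-ParityCorne-53200b5b-0, 2026-08-15T13:55:56Z; prior: Baykur arXiv:math/0601396 Thm 5.1; Breen arXiv:2311.16058 Thm 1.5–1.8 (common-contact Stein bisections / folded Weinstein structures exist on every closed oriented 4-manifold), HondaHuang arXiv:1907.06025 Thm 1.1/1.2, Prop 2 (convex hypersurfaces, bypasses in dimension 5; never aimed at 4-manifold topology), Eliashberg1990 Thm 5.1; Wendl arXiv:0806.3193 Thm 1; Etnyre arXiv:math/0404267 Thm 4.1 (fi)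

History (route lifecycle, newest last):
- 2026-08-15T16:17:31Z · rev 2: restated AcyclicBisectionRigidity (stmt-SmoothPoincare4-3544), AcyclicBisectionExists (stmt-SmoothPoincare4-3545), SteinBisectionExists (stmt-SmoothPoincare4-3547), SphereSeamStandard (stmt-SmoothPoincare4-3548), PlanarBisectionRigidity (stmt-SmoothPoincare4-3633), PlanarBisectionExists (stmt-SmoothPoincare4-364 (planner-rbadge-SmoothPoincare4-ConvexBisection-c87bb03f-g4-0)
- 2026-08-16T00:10:38Z · rev 3: restated Assembly (stmt-SmoothPoincare4-3549 proved) — route-repair (rglue, glue-native-fail): (1) deciding theorem `closes (hE : AcyclicBisectionExists) (hR : AcyclicBisectionRigidity) : SmoothPoincare4` UNCHANGED (planner-rglue-SmoothPoincare4-ConvexBisection-c87bb03f-0)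
- 2026-08-17T01:23:09Z · rev 6: dropped stmt-SmoothPoincare4-0435, stmt-SmoothPoincare4-3717, stmt-SmoothPoincare4-17141 — crux-strategist (cstrat-3546-p1): undo three top-level attachments made via workitem add at 01:2x–01:3xZ (0435 / 3717 re-asks, residual 17141) — they pushed the (planner-cstrat-stmt-SmoothPoincare4-3546-p1-0)
- 2026-08-24T16:51:44Z · DORMANT — reconciler: no traction for 6.9 d (last activity item-evidence-added at 2026-08-17T18:24:27Z); parked, not closed — `ledger route dormant route-SmoothPoincare4- (operator:999:1212060)

sub-problem: SmoothPoincare4 · status: dormant · opened planner-plancard-SmoothPoincare4-SmoothPoinca-9b785122-0 2026-08-15T11:19:49Z · rev 7 · ledger route-SmoothPoincare4-ConvexBisection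
GENERATED by the gate from the ledger (D-0016/17). Provers cite these decls: `theorem foo : Summit.SmoothPoincare4.SmoothPoincare4.Theses.ConvexBisection.<Decl> := …` in Summits/SmoothPoincare4/SmoothPoincare4/Theorems/<Name>.lean.
-/

namespace Summit.SmoothPoincare4.SmoothPoincare4.Theses.ConvexBisection

open scoped BigOperators Topology Manifold Classical MeasureTheory ProbabilityTheory Matrix InnerProductSpace ComplexConjugate ContinuousMap ContDiff
open Filter Set Function TopologicalSpace MeasureTheory

attribute [summit_statement] _root_.SmoothPoincare4

open Literature.SPC4

-- earlier AcyclicBisectionRigidity (stmt-SmoothPoincare4-3544, replaced 2026-08-15T16:17:31Z -> stmt-SmoothPoincare4-10507): retired by None — ∀ S : Literature.Topology.FourManifolds.HomotopySphere 4, (∃ (W₁ : Type) (_ : TopologicalSpace W₁) (_ : ChartedSpace (EuclideanHalfSpace 4) W₁) (_ : IsManifold (𝓡∂ 4) ∞ W₁) (_ : CompactSpace W₁) (W₂ : Type) (_ : TopologicalSpace W₂) (_ : ChartedSpace (Euclide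
/-- item stmt-SmoothPoincare4-10507 · crux · rank 2 · open · by planner
why it might fail: Fails only via an exotic S⁴, but may be SPC4-hard: no classification of ℚ-acyclic Stein fillings or of Cont(Γ,ξ) beyond lens spaces; even τ = id (doubles D(C) of contractible Stein 2-handlebodies) is AC-adjacent, and cork twists by contactomorphisms (Gompf 1603.05090 Q2.2, open) sit inside it.
sources: arXiv:1603.05090, arXiv:1607.07661, arXiv:0806.3193, arXiv:math/0404267, arXiv:2006.16687, Eliashberg1990
[crux] for every homotopy 4-sphere Σ: if Σ admits a Stein bisection along a common contact seam (two
compact Stein domains (W₁,J₁), (W₂,J₂) smoothly embedded, ranges covering Σ and meeting exactly in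
the images of their boundaries, pushed-forward complex tangencies equal at every seam point) whose
halves are rationally acyclic (H_k(Wᵢ;ℚ) = 0 for k > 0; ⇔ seam a connected ℚHS³, forced by planarity
via Etnyre + Mayer–Vietoris), then Σ ≅ S⁴. Card item B2 with "planar" weakened to its homological
consequence; sub-sectors: seam S³ (support SphereSeamStandard, known), contractible halves (crux 4),
planar seam (crux PlanarBisectionRigidity, Wendl ⇒ pairs of positive factorisations of one planar
monodromy), finite-π₁ halves (census: lens-space and lens-sum seams are already excluded by H₁(Γ) ≅
H₁(W₁) ⊕ H₁(W₂) with |H₁(Wᵢ)|² = |H₁(Γ)| and Lisca/Etnyre–Roy arXiv:2006.16687). [difficulty: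
open-problem] (Lean form UNBUNDLED 2026-08-15, route-repair g4: Σ ranges over every Hausdorff
second-countable C^∞ 4-manifold M with M ≃ₕ S⁴ — the shape of the Statement itself — instead of
`HomotopySphere 4`; same content, since compactness and orientability of such M are the PROVED facts
Literature.Topolog -/
@[route_item "route-SmoothPoincare4-ConvexBisection", crux]
def AcyclicBisectionRigidity : Prop :=
  ∀ (M : Type) [TopologicalSpace M] [T2Space M] [SecondCountableTopology M] [ChartedSpace (EuclideanSpace ℝ (Fin 4)) M] [IsManifold (𝓡 4) ∞ M], M ≃ₕ Metric.sphere (0 : EuclideanSpace ℝ (Fin 5)) 1 → (∃ (W₁ : Type) (_ : TopologicalSpace W₁) (_ : ChartedSpace (EuclideanHalfSpace 4) W₁) (_ : IsManifold (𝓡∂ 4) ∞ W₁) (_ : CompactSpace W₁) (W₂ : Type) (_ : TopologicalSpace W₂) (_ : ChartedSpace (EuclideanHalfSpace 4) W₂) (_ : IsManifold (𝓡∂ 4) ∞ W₂) (_ : CompactSpace W₂) (J₁ : Literature.Geometry.Symplectic.SteinStructure W₁) (J₂ : Literature.Geometry.Symplectic.SteinStructure W₂) (e₁ : W₁ → M)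 (e₂ : W₂ → M), Manifold.IsSmoothEmbedding (𝓡∂ 4) (𝓡 4) ∞ e₁ ∧ Manifold.IsSmoothEmbedding (𝓡∂ 4) (𝓡 4) ∞ e₂ ∧ Set.range e₁ ∪ Set.range e₂ = Set.univ ∧ Set.range e₁ ∩ Set.range e₂ = e₁ '' (𝓡∂ 4).boundary W₁ ∧ Set.range e₁ ∩ Set.range e₂ = e₂ '' (𝓡∂ 4).boundary W₂ ∧ (∀ w₁ w₂, e₁ w₁ = e₂ w₂ → Submodule.map (mfderiv (𝓡∂ 4) (𝓡 4) e₁ w₁).toLinearMap (Literature.Geometry.Symplectic.contactPlane J₁.J w₁) = Submodule.map (mfderiv (𝓡∂ 4) (𝓡 4) e₂ w₂).toLinearMap (Literature.Geometry.Symplectic.contactPlane J₂.J w₂)) ∧ (∀ k, 0 < k → CategoryTheory.Limits.IsZero (Literature.AlgebraicTopology.SingularHomology.singularHomology ℚ ℚ W₁ k) ∧ CategoryTheory.Limits.IsZero (Literature.AlgebraicTopology.SingularHomology.singularHomology ℚ ℚ W₂ k))) → Nonempty (M ≃ₘ⟮𝓡 4, 𝓡 4⟯ Metric.sphere (0 :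 EuclideanSpace ℝ (Fin 5)) 1)

-- earlier AcyclicBisectionExists (stmt-SmoothPoincare4-3545, replaced 2026-08-15T16:17:31Z -> stmt-SmoothPoincare4-10508): retired by None — ∀ S : Literature.Topology.FourManifolds.HomotopySphere 4, ∃ (W₁ : Type) (_ : TopologicalSpace W₁) (_ : ChartedSpace (EuclideanHalfSpace 4) W₁) (_ : IsManifold (𝓡∂ 4) ∞ W₁) (_ : CompactSpace W₁) (W₂ : Type) (_ : TopologicalSpace W₂) (_ : ChartedSpace (EuclideanH
/-- item stmt-SmoothPoincare4-10508 · crux · rank 3 · open · by planner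
why it might fail: Honda–Huang 1907.06025 p.4: no technology yet to simplify dividing sets in dimension 5; an exotic Σ might force b₁(Γ) > 0 or disconnected Γ in every convex position / folded Weinstein structure — an obstruction nobody can currently compute (nor realise the simplification).
sources: arXiv:1907.06025, arXiv:1803.09142, arXiv:2311.16058, arXiv:math/0601396, arXiv:math/0404267, KervaireMilnor1963
[crux] every homotopy 4-sphere Σ admits a Stein bisection along a common contact seam whose two
halves are rationally acyclic (equivalently, by Mayer–Vietoris in the homology sphere Σ, whose seam
Γ is a connected rational homology 3-sphere). Card item B1's output: intended proof = embed Σ ⊂ (S⁵,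
ξ_std) = ∂B⁶ ⊃ D(V⁵) (Σ = ∂V, V contractible, Kervaire–Milnor), make it convex (Honda–Huang Thm 1.1,
R± Weinstein by Prop 2, Stein by Cieliebak–Eliashberg/Gompf in dimension 4), then lower (genus of a
supporting open book of Γ, b₁(Γ), #π₀Γ) by bypasses realised inside S⁵ (Thm 1.2) until Γ is planar
and connected; Etnyre Thm 4.1 + vanishing intersection forms Q(Wᵢ) ≡ 0 (codimension-0 pieces of a
homology sphere) then give b₂(Wᵢ) = 0 and the χ-count gives b₁ = b₃ = 0. Trivially true for S⁴ (B⁴ ∪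
B̄⁴, Γ = S³; also D(C) for every Stein cork C). [difficulty: open-problem] (Lean form UNBUNDLED
2026-08-15, route-repair g4: Σ ranges over every Hausdorff second-countable C^∞ 4-manifold M with M
≃ₕ S⁴ — the shape of the Statement itself — instead of `HomotopySphere 4`; same content, since
compactness and orientability of such M are the PROVED facts
Literature.Topology.FourManifolds.compactSpace_of_ho -/
@[route_item "route-SmoothPoincare4-ConvexBisection", crux]
def AcyclicBisectionExists : Prop :=
  ∀ (M : Type) [TopologicalSpace M] [T2Space M] [SecondCountableTopology M] [ChartedSpace (EuclideanSpace ℝ (Fin 4)) M] [IsManifold (𝓡 4) ∞ M], M ≃ₕ Metric.sphere (0 : EuclideanSpace ℝ (Fin 5)) 1 → ∃ (W₁ : Type) (_ : TopologicalSpace W₁) (_ : ChartedSpace (EuclideanHalfSpace 4) W₁) (_ : IsManifold (𝓡∂ 4) ∞ W₁) (_ : CompactSpace W₁) (W₂ : Type) (_ : TopologicalSpace W₂) (_ : ChartedSpace (EuclideanHalfSpace 4) W₂) (_ : IsManifold (𝓡∂ 4) ∞ W₂) (_ : CompactSpace W₂) (J₁ : Literature.Geometry.Symplectic.SteinStructure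 W₁) (J₂ : Literature.Geometry.Symplectic.SteinStructure W₂) (e₁ : W₁ → M) (e₂ : W₂ → M), Manifold.IsSmoothEmbedding (𝓡∂ 4) (𝓡 4) ∞ e₁ ∧ Manifold.IsSmoothEmbedding (𝓡∂ 4) (𝓡 4) ∞ e₂ ∧ Set.range e₁ ∪ Set.range e₂ = Set.univ ∧ Set.range e₁ ∩ Set.range e₂ = e₁ '' (𝓡∂ 4).boundary W₁ ∧ Set.range e₁ ∩ Set.range e₂ = e₂ '' (𝓡∂ 4).boundary W₂ ∧ (∀ w₁ w₂, e₁ w₁ = e₂ w₂ → Submodule.map (mfderiv (𝓡∂ 4) (𝓡 4) e₁ w₁).toLinearMap (Literature.Geometry.Symplectic.contactPlane J₁.J w₁) = Submodule.map (mfderiv (𝓡∂ 4) (𝓡 4) e₂ w₂).toLinearMap (Literature.Geometry.Symplectic.contactPlane J₂.J w₂)) ∧ (∀ k, 0 < k → CategoryTheory.Limits.IsZero (Literature.AlgebraicTopology.SingularHomology.singularHomology ℚ ℚ W₁ k) ∧ CategoryTheory.Limits.IsZero (Literature.AlgebraicTopology.SingularHomology.singularHomology ℚ ℚ W₂ k)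)

/-- item stmt-SmoothPoincare4-3546 · crux · rank 4 · open · by planner
why it might fail: Gompf 1603.05090 Q2.2 (is iterated cork twisting in S⁴ standard?) is open even smoothly; already τ = id asks D(C) ≅ S⁴ for every contractible Stein 2-handlebody C (Andrews–Curtis-adjacent); a cork (C,τ) with τ a contactomorphism of ξ_C and C ∪_τ C̄ exotic kills it (and SPC4).
sources: arXiv:1603.05090, arXiv:1607.07661, arXiv:1406.5865, arXiv:1603.07710, Akbulut1991Fake, AkbulutMatveyev1998
[crux] the cork sector of crux 2, stated without homotopy spheres: if a closed (compact, Hausdorff,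
second countable) smooth 4-manifold X is a Stein bisection along a common contact seam of two
compact CONTRACTIBLE Stein domains (W₁,J₁), (W₂,J₂), then X ≅ S⁴. Such X is automatically a homotopy
sphere (van Kampen + Mayer–Vietoris); examples realised in S⁴: D(C) = C ∪_id C̄ for every Stein cork
C (Mazur: C × I = B⁵), in particular with the PLANAR Stein structure of the Akbulut cork (Ukida;
Karakurt–Oba–Ukida Prop 2.3: page = disc with n+3 holes, monodromy t_a t_b t_c t_d1 ⋯ t_dn). The
content: a contactomorphism ψ : (∂W₁,ξ₁) → (∂W₂,ξ₂) between boundaries of contractible Stein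
fillings glues to S⁴ — cork twists compatible with the Stein contact structures do not produce
exotica. First test family: W₁ = W₂ = Akbulut cork with KOU's structures J₁ (Legendrian handlebody)
/ J₂ (planar PALF), ψ ∈ {id, cork involution τ} whenever τ^*ξ is isotopic to ξ. [deps:
AcyclicBisectionRigidity] [difficulty: XL] -/
@[route_item "route-SmoothPoincare4-ConvexBisection", crux]
def ContractibleTwistedDoubleStandard : Prop :=
  ∀ (X : Type) [TopologicalSpace X] [T2Space X] [SecondCountableTopology X] [CompactSpace X] [ChartedSpace (EuclideanSpace ℝ (Fin 4)) X] [IsManifold (𝓡 4) ∞ X] (W₁ : Type) [TopologicalSpace W₁] [ChartedSpace (EuclideanHalfSpace 4) W₁] [IsManifold (𝓡∂ 4) ∞ W₁] [CompactSpace W₁] [ContractibleSpace W₁] (W₂ : Type) [TopologicalSpace W₂] [ChartedSpace (EuclideanHalfSpace 4) W₂] [IsManifold (𝓡∂ 4) ∞ W₂] [CompactSpace W₂] [ContractibleSpace W₂] (J₁ : Literature.Geometry.Symplectic.SteinStructure W₁) (J₂ : Literature.Geometry.Symplectic.SteinStructure W₂) (e₁ : W₁ → X) (e₂ : W₂ →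 X), Manifold.IsSmoothEmbedding (𝓡∂ 4) (𝓡 4) ∞ e₁ → Manifold.IsSmoothEmbedding (𝓡∂ 4) (𝓡 4) ∞ e₂ → Set.range e₁ ∪ Set.range e₂ = Set.univ → Set.range e₁ ∩ Set.range e₂ = e₁ '' (𝓡∂ 4).boundary W₁ → Set.range e₁ ∩ Set.range e₂ = e₂ '' (𝓡∂ 4).boundary W₂ → (∀ w₁ w₂, e₁ w₁ = e₂ w₂ → Submodule.map (mfderiv (𝓡∂ 4) (𝓡 4) e₁ w₁).toLinearMap (Literature.Geometry.Symplectic.contactPlane J₁.J w₁) = Submodule.map (mfderiv (𝓡∂ 4) (𝓡 4) e₂ w₂).toLinearMap (Literature.Geometry.Symplectic.contactPlane J₂.J w₂)) → Nonempty (X ≃ₘ⟮𝓡 4, 𝓡 4⟯ Metric.sphere (0 : EuclideanSpace ℝ (Fin 5)) 1)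

/-- item stmt-SmoothPoincare4-15086 · crux · rank 5 · open · by planner
why it might fail: Two Hurwitz-inequivalent positive factorisations of one planar monodromy with ℚ-acyclic total spaces, glued along the common book, could be exotic; none known (k=4: all reflection-twin cork twists of S⁴, Disproof §7); planar factorisations scarce (PVHM 0912.1916, Kaloti 1311.0208).
sources: arXiv:0806.3193, arXiv:math/0404267, arXiv:0912.1916, arXiv:1311.0208, arXiv:1406.5865, arXiv:1607.07661
[crux] PLANAR SECTOR of crux 2 (route-choice repair 2026-08-16; supersedes PlanarBisectionRigidity
stmt-SmoothPoincare4-10511 as the staffed crux 5). For every Hausdorff second-countable C^∞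
4-manifold M ≃ₕ S⁴: if M admits a Stein bisection along a common contact seam — verbatim the
hypothesis of AcyclicBisectionRigidity: compact Stein domains (W₁,J₁), (W₂,J₂) smoothly embedded,
ranges covering M and meeting exactly in the images of their boundaries, pushed-forward complex
tangencies equal on the seam, BOTH HALVES ℚ-ACYCLIC in positive degrees — and the J₁-induced contact
structure on ∂W₁ is supported by a PLANAR open book
(Literature.Geometry.Symplectic.PlanarContactBoundary J₁; planarity of J₂ follows, landed
stub_planarSeamTransfer p76418), then M ≅ S⁴. Differs from stmt-10511 ONLY by carrying the halves'
ℚ-acyclicity as a hypothesis instead of deriving it from planarity; that derivation is Etnyre 2004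
Thm 4.1 (planar ⇒ b₂⁰ = 0; tree fact Literature.Geometry.Symplectic.EtnyrePlanarFilling, clause (ii)
unproved — Eliashberg 2-handle caps + McDuff's ruled classification, formally XL) + Q(Wᵢ) ≡ 0 in the
homology sphere + Mayer–Vietoris (proved MODULO the fact in Theorems/ConvexBise -/
@[route_item "route-SmoothPoincare4-ConvexBisection", crux]
def PlanarAcyclicBisectionRigidity : Prop :=
  ∀ (M : Type) [TopologicalSpace M] [T2Space M] [SecondCountableTopology M] [ChartedSpace (EuclideanSpace ℝ (Fin 4)) M] [IsManifold (𝓡 4) ∞ M], M ≃ₕ Metric.sphere (0 : EuclideanSpace ℝ (Fin 5)) 1 → (∃ (W₁ : Type) (_ : TopologicalSpace W₁) (_ : ChartedSpace (EuclideanHalfSpace 4) W₁) (_ : IsManifold (𝓡∂ 4) ∞ W₁) (_ : CompactSpace W₁) (W₂ : Type) (_ : TopologicalSpace W₂) (_ : ChartedSpace (EuclideanHalfSpace 4) W₂) (_ : IsManifold (𝓡∂ 4) ∞ W₂) (_ : CompactSpace W₂) (J₁ : Literature.Geometry.Symplectic.SteinStructure W₁) (J₂ : Literature.Geometry.Symplectic.SteinStructure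 W₂) (e₁ : W₁ → M) (e₂ : W₂ → M), Manifold.IsSmoothEmbedding (𝓡∂ 4) (𝓡 4) ∞ e₁ ∧ Manifold.IsSmoothEmbedding (𝓡∂ 4) (𝓡 4) ∞ e₂ ∧ Set.range e₁ ∪ Set.range e₂ = Set.univ ∧ Set.range e₁ ∩ Set.range e₂ = e₁ '' (𝓡∂ 4).boundary W₁ ∧ Set.range e₁ ∩ Set.range e₂ = e₂ '' (𝓡∂ 4).boundary W₂ ∧ (∀ w₁ w₂, e₁ w₁ = e₂ w₂ → Submodule.map (mfderiv (𝓡∂ 4) (𝓡 4) e₁ w₁).toLinearMap (Literature.Geometry.Symplectic.contactPlane J₁.J w₁) = Submodule.map (mfderiv (𝓡∂ 4) (𝓡 4) e₂ w₂).toLinearMap (Literature.Geometry.Symplectic.contactPlane J₂.J w₂)) ∧ (∀ k, 0 < k → CategoryTheory.Limits.IsZero (Literature.AlgebraicTopology.SingularHomology.singularHomology ℚ ℚ W₁ k) ∧ CategoryTheory.Limits.IsZero (Literature.AlgebraicTopology.SingularHomology.singularHomology ℚ ℚ W₂ k)) ∧ Literature.Geometry.Symplectic.PlanarContactBoundary J₁)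 → Nonempty (M ≃ₘ⟮𝓡 4, 𝓡 4⟯ Metric.sphere (0 : EuclideanSpace ℝ (Fin 5)) 1)

/-- item stmt-SmoothPoincare4-14769 · crux · rank 6 · open · by planner
why it might fail: No engine here: a non-planar seam voids Wendl's normal form and non-simply-connected ℚ-acyclic Stein halves (rational balls X_p, π₁ = ℤ/p, over small Seifert seams −Y(p); finite perfect π₁) have no filling classification — may be exactly SPC4-hard; fails only via an exotic S⁴.
sources: arXiv:math/9803019, arXiv:math/0509714, doi:10.1007/bf01432386, doi:10.1512/iumj.1974.23.23066, arXiv:1803.08749, arXiv:2006.16687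
[crux] RESIDUAL SECTOR of crux 2 AcyclicBisectionRigidity (route-repair 2026-08-16, unused-crux;
makes cruxes 4 and 5 feed the deciding theorem): for every Hausdorff second-countable C^∞ 4-manifold
M with M ≃ₕ S⁴ — if M admits a Stein bisection along a common contact seam with ℚ-acyclic halves
(verbatim the hypothesis of AcyclicBisectionRigidity) such that IN ADDITION the J₁-induced contact
structure on ∂W₁ is NOT supported by a planar open book (¬ PlanarContactBoundary J₁; by the contact
matching (∂W₁,ξ₁) ≅ (∂W₂,ξ₂), so this is planarity of the seam) and the halves are NOT both
contractible (¬ (ContractibleSpace W₁ ∧ ContractibleSpace W₂); with ℚ-acyclicity and connected Stein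
boundaries: some half has non-trivial π₁), then M ≅ S⁴. Logical role: AcyclicBisectionRigidity ⇐
PlanarBisectionRigidity (planar seam, Wendl engine) + ContractibleTwistedDoubleStandard (both halves
contractible, cork/AC sector) + THIS item, by case analysis (support item AcyclicRigidityBySectors,
pure logic); conversely the crux implies this item in one line, so it is a weakening of crux 2 and,
like it, implied by SPC4 (refutable only by an exotic 4-sphere). It is exactly the part of crux 2
for which NO engi -/
@[route_item "route-SmoothPoincare4-ConvexBisection"]
def ResidualAcyclicBisectionRigidity : Prop :=
  ∀ (M : Type) [TopologicalSpace M] [T2Space M] [SecondCountableTopology M] [ChartedSpace (EuclideanSpace ℝ (Fin 4)) M] [IsManifold (𝓡 4) ∞ M], M ≃ₕ Metric.sphere (0 : EuclideanSpace ℝ (Fin 5)) 1 → (∃ (W₁ : Type) (_ : TopologicalSpace W₁) (_ : ChartedSpace (EuclideanHalfSpace 4) W₁) (_ : IsManifold (𝓡∂ 4) ∞ W₁) (_ : CompactSpace W₁) (W₂ : Type) (_ : TopologicalSpace W₂) (_ : ChartedSpace (EuclideanHalfSpace 4) W₂) (_ : IsManifold (𝓡∂ 4) ∞ W₂) (_ :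 CompactSpace W₂) (J₁ : Literature.Geometry.Symplectic.SteinStructure W₁) (J₂ : Literature.Geometry.Symplectic.SteinStructure W₂) (e₁ : W₁ → M) (e₂ : W₂ → M), Manifold.IsSmoothEmbedding (𝓡∂ 4) (𝓡 4) ∞ e₁ ∧ Manifold.IsSmoothEmbedding (𝓡∂ 4) (𝓡 4) ∞ e₂ ∧ Set.range e₁ ∪ Set.range e₂ = Set.univ ∧ Set.range e₁ ∩ Set.range e₂ = e₁ '' (𝓡∂ 4).boundary W₁ ∧ Set.range e₁ ∩ Set.range e₂ = e₂ '' (𝓡∂ 4).boundary W₂ ∧ (∀ w₁ w₂, e₁ w₁ = e₂ w₂ → Submodule.map (mfderiv (𝓡∂ 4) (𝓡 4) e₁ w₁).toLinearMap (Literature.Geometry.Symplectic.contactPlane J₁.J w₁) = Submodule.map (mfderiv (𝓡∂ 4) (𝓡 4) e₂ w₂).toLinearMap (Literature.Geometry.Symplectic.contactPlane J₂.J w₂)) ∧ (∀ k, 0 < k → CategoryTheory.Limits.IsZero (Literature.AlgebraicTopology.SingularHomology.singularHomology ℚ ℚ W₁ k) ∧ CategoryTheory.Limits.IsZero (Literature.AlgebraicTopology.SingularHomology.singularHomology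 ℚ ℚ W₂ k)) ∧ ¬ Literature.Geometry.Symplectic.PlanarContactBoundary J₁ ∧ ¬ (ContractibleSpace W₁ ∧ ContractibleSpace W₂)) → Nonempty (M ≃ₘ⟮𝓡 4, 𝓡 4⟯ Metric.sphere (0 : EuclideanSpace ℝ (Fin 5)) 1)

-- earlier PlanarBisectionRigidity (stmt-SmoothPoincare4-3633, replaced 2026-08-15T16:17:31Z -> stmt-SmoothPoincare4-10511): retired by None — ∀ S : Literature.Topology.FourManifolds.HomotopySphere 4, (∃ (W₁ : Type) (_ : TopologicalSpace W₁) (_ : ChartedSpace (EuclideanHalfSpace 4) W₁) (_ : IsManifold (𝓡∂ 4) ∞ W₁) (_ : CompactSpace W₁) (W₂ : Type) (_ : TopologicalSpace W₂) (_ : ChartedSpace (Euclidea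
/-- item stmt-SmoothPoincare4-10511 · support · rank 5 · open · by planner
why it might fail: As the new crux 5 plus: closable only via Etnyre 2004 Thm 4.1 (planar ⇒ b₂⁰=0; EtnyrePlanarFilling clause (ii), unproved XL fact) — vestigial, not to be staffed.
sources: arXiv:0806.3193, arXiv:math/0404267, arXiv:0912.1916, arXiv:1311.0208, arXiv:1406.5865, arXiv:1607.07661
[crux] PlanarBisectionRigidity (card B2-PLANAR; typed 2026-08-15 by grounder g15-24 over
Literature.Geometry.Symplectic.PlanarContactBoundary, definition landed). Statement: for every
homotopy 4-sphere Σ, if Σ admits a Stein bisection along a common contact seam (as in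
AcyclicBisectionRigidity: compact Stein domains (W₁,J₁), (W₂,J₂) smoothly embedded, covering Σ,
meeting exactly along the images of their boundaries, pushed-forward complex tangencies equal on the
seam) such that the induced contact structure on ∂W₁ is supported by a PLANAR open book (pages of
genus 0), then Σ ≅ S⁴. Relation: special case of AcyclicBisectionRigidity (planar seam ⇒ b₂⁺ = b₂⁰ =
0 and connected boundary for each half, Etnyre arXiv:math/0404267 Thm 4.1; with Q(Wᵢ) ≡ 0 inside the
homology sphere and the χ-count both halves are ℚ-acyclic), filed separately because it has an
engine: by Wendl arXiv:0806.3193 Thm 1 each half is (after deformation) a planar Lefschetz fibration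
over ANY chosen planar supporting open book, so Σ ≅ X_F₊ ∪_id X̄_F₋ for two positive factorisations
F₊, F₋ of one planar monodromy φ ∈ Mod(P_k, ∂) glued along the common boundary open book (modulo the
symmetries of (P_k, φ) — the bookkee -/
@[route_item "route-SmoothPoincare4-ConvexBisection"]
def PlanarBisectionRigidity : Prop :=
  ∀ (M : Type) [TopologicalSpace M] [T2Space M] [SecondCountableTopology M] [ChartedSpace (EuclideanSpace ℝ (Fin 4)) M] [IsManifold (𝓡 4) ∞ M], M ≃ₕ Metric.sphere (0 : EuclideanSpace ℝ (Fin 5)) 1 → (∃ (W₁ : Type) (_ : TopologicalSpace W₁) (_ : ChartedSpace (EuclideanHalfSpace 4) W₁) (_ : IsManifold (𝓡∂ 4) ∞ W₁) (_ : CompactSpace W₁) (W₂ : Type) (_ : TopologicalSpace W₂) (_ : ChartedSpace (EuclideanHalfSpace 4) W₂) (_ : IsManifold (𝓡∂ 4) ∞ W₂) (_ : CompactSpace W₂) (J₁ : Literature.Geometry.Symplectic.SteinStructure W₁) (J₂ : Literature.Geometry.Symplectic.SteinStructure W₂) (e₁ : W₁ → M) (e₂ : W₂ → M), Manifold.IsSmoothEmbedding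 (𝓡∂ 4) (𝓡 4) ∞ e₁ ∧ Manifold.IsSmoothEmbedding (𝓡∂ 4) (𝓡 4) ∞ e₂ ∧ Set.range e₁ ∪ Set.range e₂ = Set.univ ∧ Set.range e₁ ∩ Set.range e₂ = e₁ '' (𝓡∂ 4).boundary W₁ ∧ Set.range e₁ ∩ Set.range e₂ = e₂ '' (𝓡∂ 4).boundary W₂ ∧ (∀ w₁ w₂, e₁ w₁ = e₂ w₂ → Submodule.map (mfderiv (𝓡∂ 4) (𝓡 4) e₁ w₁).toLinearMap (Literature.Geometry.Symplectic.contactPlane J₁.J w₁) = Submodule.map (mfderiv (𝓡∂ 4) (𝓡 4) e₂ w₂).toLinearMap (Literature.Geometry.Symplectic.contactPlane J₂.J w₂)) ∧ Literature.Geometry.Symplectic.PlanarContactBoundary J₁) → Nonempty (M ≃ₘ⟮𝓡 4, 𝓡 4⟯ Metric.sphere (0 : EuclideanSpace ℝ (Fin 5)) 1)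

-- earlier SteinBisectionExists (stmt-SmoothPoincare4-3547, replaced 2026-08-15T16:17:31Z -> stmt-SmoothPoincare4-10509): retired by None — ∀ S : Literature.Topology.FourManifolds.HomotopySphere 4, ∃ (W₁ : Type) (_ : TopologicalSpace W₁) (_ : ChartedSpace (EuclideanHalfSpace 4) W₁) (_ : IsManifold (𝓡∂ 4) ∞ W₁) (_ : CompactSpace W₁) (W₂ : Type) (_ : TopologicalSpace W₂) (_ : ChartedSpace (EuclideanHal
/-- item stmt-SmoothPoincare4-10509 · support · rank 9 · open · by planner
sources: arXiv:math/0601396, arXiv:2311.16058, arXiv:1907.06025, Gompf1998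
[support] every homotopy 4-sphere admits a Stein bisection along a common contact seam (no
acyclicity). KNOWN modulo vendoring: Baykur 2006 Thm 5.1 (every closed oriented smooth 4-manifold is
X₊ ∪ X₋ with X₊, −X₋ Stein inducing isotopic contact structures on the fold, with matching PALF open
books) = Breen 2023 Thm 1.6 (folded Weinstein structures exist) = Honda–Huang Thm 1.1 + Prop 2
applied to Σ ⊂ S⁵; plus Gray stability to make the plane fields agree pointwise and `SteinStructure`
packaging (regular maximal level set). The arena of cruxes 2–3 is therefore never empty; provers
vendor Baykur Thm 5.1 as a named fact and discharge this item from it. [difficulty: L] (Lean form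
UNBUNDLED 2026-08-15, route-repair g4: Σ ranges over every Hausdorff second-countable C^∞ 4-manifold
M with M ≃ₕ S⁴ — the shape of the Statement itself — instead of `HomotopySphere 4`; same content,
since compactness and orientability of such M are the PROVED facts
Literature.Topology.FourManifolds.compactSpace_of_homotopyEquiv_sphere_four_holds /
isOrientable_of_homotopyEquiv_sphere_four_holds; this drops import HomotopySpheres from the route
cone and makes the deciding theorem pure logic.) -/
@[route_item "route-SmoothPoincare4-ConvexBisection"]
def SteinBisectionExists : Prop :=
  ∀ (M : Type) [TopologicalSpace M] [T2Space M] [SecondCountableTopology M] [ChartedSpace (EuclideanSpace ℝ (Fin 4)) M] [IsManifold (𝓡 4) ∞ M], M ≃ₕ Metric.sphere (0 : EuclideanSpace ℝ (Fin 5)) 1 → ∃ (W₁ : Type) (_ : TopologicalSpace W₁) (_ : ChartedSpace (EuclideanHalfSpace 4) W₁) (_ : IsManifold (𝓡∂ 4) ∞ W₁) (_ : CompactSpace W₁) (W₂ : Type) (_ : TopologicalSpace W₂) (_ : ChartedSpace (EuclideanHalfSpace 4) W₂) (_ : IsManifold (𝓡∂ 4) ∞ W₂) (_ : CompactSpace W₂)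 (J₁ : Literature.Geometry.Symplectic.SteinStructure W₁) (J₂ : Literature.Geometry.Symplectic.SteinStructure W₂) (e₁ : W₁ → M) (e₂ : W₂ → M), Manifold.IsSmoothEmbedding (𝓡∂ 4) (𝓡 4) ∞ e₁ ∧ Manifold.IsSmoothEmbedding (𝓡∂ 4) (𝓡 4) ∞ e₂ ∧ Set.range e₁ ∪ Set.range e₂ = Set.univ ∧ Set.range e₁ ∩ Set.range e₂ = e₁ '' (𝓡∂ 4).boundary W₁ ∧ Set.range e₁ ∩ Set.range e₂ = e₂ '' (𝓡∂ 4).boundary W₂ ∧ (∀ w₁ w₂, e₁ w₁ = e₂ w₂ → Submodule.map (mfderiv (𝓡∂ 4) (𝓡 4) e₁ w₁).toLinearMap (Literature.Geometry.Symplectic.contactPlane J₁.J w₁) = Submodule.map (mfderiv (𝓡∂ 4) (𝓡 4) e₂ w₂).toLinearMap (Literature.Geometry.Symplectic.contactPlane J₂.J w₂))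

-- earlier SphereSeamStandard (stmt-SmoothPoincare4-3548, replaced 2026-08-15T16:17:31Z -> stmt-SmoothPoincare4-10510): retired by None — ∀ S : Literature.Topology.FourManifolds.HomotopySphere 4, (∃ (W₁ : Type) (_ : TopologicalSpace W₁) (_ : ChartedSpace (EuclideanHalfSpace 4) W₁) (_ : IsManifold (𝓡∂ 4) ∞ W₁) (_ : CompactSpace W₁) (W₂ : Type) (_ : TopologicalSpace W₂) (_ : ChartedSpace (EuclideanHalf
/-- item stmt-SmoothPoincare4-10510 · support · rank 9 · open · by planner
sources: Eliashberg1990, Eliashberg1992, CerfDiffeoSphere1968, AkbulutMatveyev1998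
[support] the Γ = S³ endpoint (degenerate planar case, disc pages): a homotopy 4-sphere with a Stein
bisection along a common contact seam homeomorphic to S³ is diffeomorphic to S⁴ — seam S³ ⇒ ξ tight
⇒ standard (Eliashberg1992) ⇒ both halves are Stein fillings of (S³,ξ_std) ⇒ B⁴ (Eliashberg1990 Thm
5.1; in tree the Gromov–McDuff twisted-sphere facts of Literature.Geometry.Symplectic) ⇒ twisted
sphere ⇒ S⁴ (Cerf Γ₄ = 0, Literature.Topology.FourManifolds.cerf_twistedSphere_four). Shares its
mathematics with route SymplecticCap's assembly for SteinSplitV2 (there: no contact-matching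
hypothesis, which for S³ is automatic); known modulo named facts. [difficulty: M] (Lean form
UNBUNDLED 2026-08-15, route-repair g4: Σ ranges over every Hausdorff second-countable C^∞ 4-manifold
M with M ≃ₕ S⁴ — the shape of the Statement itself — instead of `HomotopySphere 4`; same content,
since compactness and orientability of such M are the PROVED facts
Literature.Topology.FourManifolds.compactSpace_of_homotopyEquiv_sphere_four_holds /
isOrientable_of_homotopyEquiv_sphere_four_holds; this drops import HomotopySpheres from the route
cone and makes the deciding theorem pure logic.) -/
@[route_item "route-SmoothPoincare4-ConvexBisection", crux]
def SphereSeamStandard : Prop :=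
  ∀ (M : Type) [TopologicalSpace M] [T2Space M] [SecondCountableTopology M] [ChartedSpace (EuclideanSpace ℝ (Fin 4)) M] [IsManifold (𝓡 4) ∞ M], M ≃ₕ Metric.sphere (0 : EuclideanSpace ℝ (Fin 5)) 1 → (∃ (W₁ : Type) (_ : TopologicalSpace W₁) (_ : ChartedSpace (EuclideanHalfSpace 4) W₁) (_ : IsManifold (𝓡∂ 4) ∞ W₁) (_ : CompactSpace W₁) (W₂ : Type) (_ : TopologicalSpace W₂) (_ : ChartedSpace (EuclideanHalfSpace 4) W₂) (_ : IsManifold (𝓡∂ 4) ∞ W₂) (_ : CompactSpace W₂) (J₁ : Literature.Geometry.Symplectic.SteinStructure W₁) (J₂ : Literature.Geometry.Symplectic.SteinStructure W₂) (e₁ : W₁ → M) (e₂ : W₂ → M), Manifold.IsSmoothEmbedding (𝓡∂ 4) (𝓡 4) ∞ e₁ ∧ Manifold.IsSmoothEmbedding (𝓡∂ 4) (𝓡 4) ∞ e₂ ∧ Set.range e₁ ∪ Set.range e₂ = Set.univ ∧ Set.range e₁ ∩ Set.range e₂ = e₁ '' (𝓡∂ 4).boundary W₁ ∧ Set.range e₁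 ∩ Set.range e₂ = e₂ '' (𝓡∂ 4).boundary W₂ ∧ (∀ w₁ w₂, e₁ w₁ = e₂ w₂ → Submodule.map (mfderiv (𝓡∂ 4) (𝓡 4) e₁ w₁).toLinearMap (Literature.Geometry.Symplectic.contactPlane J₁.J w₁) = Submodule.map (mfderiv (𝓡∂ 4) (𝓡 4) e₂ w₂).toLinearMap (Literature.Geometry.Symplectic.contactPlane J₂.J w₂)) ∧ Nonempty (((𝓡∂ 4).boundary W₁) ≃ₜ Metric.sphere (0 : EuclideanSpace ℝ (Fin 4)) 1)) → Nonempty (M ≃ₘ⟮𝓡 4, 𝓡 4⟯ Metric.sphere (0 : EuclideanSpace ℝ (Fin 5)) 1)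

-- earlier PlanarBisectionExists (stmt-SmoothPoincare4-3644, replaced 2026-08-15T16:17:31Z -> stmt-SmoothPoincare4-10512): retired by None — ∀ S : Literature.Topology.FourManifolds.HomotopySphere 4, ∃ (W₁ : Type) (_ : TopologicalSpace W₁) (_ : ChartedSpace (EuclideanHalfSpace 4) W₁) (_ : IsManifold (𝓡∂ 4) ∞ W₁) (_ : CompactSpace W₁) (W₂ : Type) (_ : TopologicalSpace W₂) (_ : ChartedSpace (EuclideanHa
/-- item stmt-SmoothPoincare4-10512 · support · rank 9 · open · by planner
[support] PlanarBisectionExists (card B1; typed 2026-08-15 by grounder g15-24 over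
Literature.Geometry.Symplectic.PlanarContactBoundary, definition landed). Statement: every homotopy
4-sphere Σ admits a Stein bisection along a common contact seam (as in SteinBisectionExists) whose
seam contact structure (on ∂W₁, = on ∂W₂ via the gluing) is supported by a planar open book with
CONNECTED seam. Role: a SUFFICIENT condition for crux AcyclicBisectionExists (planar ⇒ ℚ-acyclic
halves by Etnyre arXiv:math/0404267 Thm 4.1 + Mayer–Vietoris) and the hypothesis of crux
PlanarBisectionRigidity; it is the card's intended path: Σ ⊂ (S⁵, ξ_std) convex (Honda–Huang
arXiv:1907.06025 Thm 1.1, Prop 2), then bypasses inside S⁵ (Thm 1.2, arXiv:1803.09142) lowering the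
support genus / b₁ / number of components of the dividing set Γ until Γ is connected planar (the
complexity c(Σ) of the card). Same uncertainty as AcyclicBisectionExists (HH p.4: no technology to
simplify dividing sets in dimension 5), hence filed as support, not as a separate crux. True for S⁴
(Γ = S³, disc pages; also every planar Stein cork C gives the planar bisection D(C) of S⁴: Ukida
arXiv:1406.5865, KOU arXiv:1607.07661, Oba arXiv: -/
@[route_item "route-SmoothPoincare4-ConvexBisection", crux]
def PlanarBisectionExists : Prop :=
  ∀ (M : Type) [TopologicalSpace M] [T2Space M] [SecondCountableTopology M] [ChartedSpace (EuclideanSpace ℝ (Fin 4)) M] [IsManifold (𝓡 4) ∞ M], M ≃ₕ Metric.sphere (0 : EuclideanSpace ℝ (Fin 5)) 1 → ∃ (W₁ : Type) (_ : TopologicalSpace W₁) (_ : ChartedSpace (EuclideanHalfSpace 4) W₁) (_ : IsManifold (𝓡∂ 4) ∞ W₁) (_ : CompactSpace W₁) (W₂ : Type) (_ : TopologicalSpace W₂) (_ : ChartedSpace (EuclideanHalfSpace 4) W₂) (_ : IsManifold (𝓡∂ 4) ∞ W₂) (_ : CompactSpace W₂) (J₁ : Literature.Geometry.Symplectic.SteinStructure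 W₁) (J₂ : Literature.Geometry.Symplectic.SteinStructure W₂) (e₁ : W₁ → M) (e₂ : W₂ → M), Manifold.IsSmoothEmbedding (𝓡∂ 4) (𝓡 4) ∞ e₁ ∧ Manifold.IsSmoothEmbedding (𝓡∂ 4) (𝓡 4) ∞ e₂ ∧ Set.range e₁ ∪ Set.range e₂ = Set.univ ∧ Set.range e₁ ∩ Set.range e₂ = e₁ '' (𝓡∂ 4).boundary W₁ ∧ Set.range e₁ ∩ Set.range e₂ = e₂ '' (𝓡∂ 4).boundary W₂ ∧ (∀ w₁ w₂, e₁ w₁ = e₂ w₂ → Submodule.map (mfderiv (𝓡∂ 4) (𝓡 4) e₁ w₁).toLinearMap (Literature.Geometry.Symplectic.contactPlane J₁.J w₁) = Submodule.map (mfderiv (𝓡∂ 4) (𝓡 4) e₂ w₂).toLinearMap (Literature.Geometry.Symplectic.contactPlane J₂.J w₂)) ∧ Literature.Geometry.Symplectic.PlanarContactBoundary J₁ ∧ IsConnected (Set.range e₁ ∩ Set.range e₂)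

/-- item stmt-SmoothPoincare4-14770 · support · rank 9 · closed · proved by Summit.SmoothPoincare4.SmoothPoincare4.Theorems.convexBisection_acyclicRigidityBySectors (prover) · by planner
sources: arXiv:math/0404267, arXiv:0806.3193, arXiv:1603.05090
[support] SECTOR GLUE (route-repair 2026-08-16, unused-crux): crux 2 AcyclicBisectionRigidity
follows from its three sectors — planar seam (crux 5 PlanarBisectionRigidity), both halves
contractible (crux 4 ContractibleTwistedDoubleStandard applied to X := M, compact as the union of
the two compact embedded images — or by the proved tree fact
Literature.Topology.FourManifolds.compactSpace_of_homotopyEquiv_sphere_four_holds), neither (crux 6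
ResidualAcyclicBisectionRigidity) — by `by_cases` on `PlanarContactBoundary J₁` and on
`ContractibleSpace W₁ ∧ ContractibleSpace W₂`, repacking the existential witness each time. PROVABLE
NOW: pure logic, 12 lines, kernel-checked in the planner's Sketch.lean (rc 0, axioms
propext/Classical.choice/Quot.sound; compare `contractibleSector_of_crux4` in
Cruxes/AcyclicBisectionRigidity/Disproof.lean). Effect: cruxes 4, 5, 6 enter the cone of the
deciding theorem `closes (hE : AcyclicBisectionExists) (hR : AcyclicBisectionRigidity) :
SmoothPoincare4` (closing 4 + 5 + 6 closes hR). PROVERS: as for the Assembly item, state the term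
STRUCTURALLY in a Theorems file importing only Summits.SmoothPoincare4.Statement + this route's
Literature modules (do not im -/
@[route_item "route-SmoothPoincare4-ConvexBisection"]
def AcyclicRigidityBySectors : Prop :=
  PlanarBisectionRigidity → ContractibleTwistedDoubleStandard → ResidualAcyclicBisectionRigidity → AcyclicBisectionRigidity

/-- `AcyclicRigidityBySectors` holds: proved by `Summit.SmoothPoincare4.SmoothPoincare4.Theorems.convexBisection_acyclicRigidityBySectors`. -/
theorem AcyclicRigidityBySectors_holds : AcyclicRigidityBySectors := _root_.Summit.SmoothPoincare4.SmoothPoincare4.Theorems.convexBisection_acyclicRigidityBySectors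

/-- item stmt-SmoothPoincare4-15001 · support · rank 9 · open · by planner
[support] SMOOTH SEAM-S³ ENDPOINT (route-choice repair 2026-08-16, unit rchoice-…-ee25fbd7; the
Perelman-free, smoothing-uniqueness-free form of the ROLE of SphereSeamStandard
stmt-SmoothPoincare4-10510): for every Hausdorff second-countable C^∞ M ≃ₕ S⁴ with a Stein bisection
along a common contact seam — verbatim the bisection hypothesis of the route's items (compact Stein
domains (W₁,J₁), (W₂,J₂) smoothly embedded, covering M, meeting exactly in the images of their
boundaries, pushed-forward complex tangencies equal on the seam) — such that SOME boundary datum of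
W₁ (Literature.Topology.FourManifolds.BoundaryData (𝓡∂ 4) W₁ (𝓡 3): the boundary ∂W₁ as an abstract
smooth 3-manifold with its embedding) has carrier DIFFEOMORPHIC to the round S³, M ≅ S⁴. KNOWN
modulo two named facts and PROVABLE NOW in that conditional form: Eliashberg 1990 Thm 5.1
(Literature.Geometry.Symplectic.Eliashberg1990_steinFilling_sphere_three: a compact Stein domain
bounded by a smooth S³ is 𝔻⁴ — applied to W₁, then to W₂ through the seam diffeomorphism) + Cerf
1968 Γ₄ = 0 (Literature.Topology.FourManifolds.cerf_twistedSphere_four): the landed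
Theorems.nonempty_diffeomorph_sphere_four_of_steinBisection_of_di -/
@[route_item "route-SmoothPoincare4-ConvexBisection"]
def SmoothSphereSeamStandard : Prop :=
  ∀ (M : Type) [TopologicalSpace M] [T2Space M] [SecondCountableTopology M] [ChartedSpace (EuclideanSpace ℝ (Fin 4)) M] [IsManifold (𝓡 4) ∞ M], M ≃ₕ Metric.sphere (0 : EuclideanSpace ℝ (Fin 5)) 1 → (∃ (W₁ : Type) (_ : TopologicalSpace W₁) (_ : ChartedSpace (EuclideanHalfSpace 4) W₁) (_ : IsManifold (𝓡∂ 4) ∞ W₁) (_ : CompactSpace W₁) (W₂ : Type) (_ : TopologicalSpace W₂) (_ : ChartedSpace (EuclideanHalfSpace 4) W₂) (_ : IsManifold (𝓡∂ 4) ∞ W₂) (_ : CompactSpace W₂) (J₁ : Literature.Geometry.Symplectic.SteinStructure W₁) (J₂ : Literature.Geometry.Symplectic.SteinStructure W₂) (e₁ : W₁ → M) (e₂ : W₂ → M), Manifold.IsSmoothEmbedding (𝓡∂ 4) (𝓡 4) ∞ e₁ ∧ Manifold.IsSmoothEmbedding (𝓡∂ 4) (𝓡 4) ∞ e₂ ∧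 Set.range e₁ ∪ Set.range e₂ = Set.univ ∧ Set.range e₁ ∩ Set.range e₂ = e₁ '' (𝓡∂ 4).boundary W₁ ∧ Set.range e₁ ∩ Set.range e₂ = e₂ '' (𝓡∂ 4).boundary W₂ ∧ (∀ w₁ w₂, e₁ w₁ = e₂ w₂ → Submodule.map (mfderiv (𝓡∂ 4) (𝓡 4) e₁ w₁).toLinearMap (Literature.Geometry.Symplectic.contactPlane J₁.J w₁) = Submodule.map (mfderiv (𝓡∂ 4) (𝓡 4) e₂ w₂).toLinearMap (Literature.Geometry.Symplectic.contactPlane J₂.J w₂)) ∧ (∃ b : Literature.Topology.FourManifolds.BoundaryData (𝓡∂ 4) W₁ (𝓡 3), Nonempty (b.carrier ≃ₘ⟮𝓡 3, 𝓡 3⟯ Metric.sphere (0 : EuclideanSpace ℝ (Fin 4)) 1))) → Nonempty (M ≃ₘ⟮𝓡 4, 𝓡 4⟯ Metric.sphere (0 : EuclideanSpace ℝ (Fin 5)) 1)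

/-- item stmt-SmoothPoincare4-15087 · support · rank 9 · closed · proved by Summit.SmoothPoincare4.SmoothPoincare4.Theorems.convexBisection_acyclicRigidityBySectorsPA (prover) · by planner
sources: arXiv:math/0404267, arXiv:0806.3193, arXiv:1603.05090
[support] SECTOR GLUE, Etnyre-free form (route-choice repair 2026-08-16): crux 2
AcyclicBisectionRigidity follows from its three sectors — planar seam (NEW crux 5
PlanarAcyclicBisectionRigidity), both halves contractible (crux 4 ContractibleTwistedDoubleStandard
applied to X := M, compact as the union of the two compact embedded images), neither (crux 6
ResidualAcyclicBisectionRigidity) — by `by_cases` on `PlanarContactBoundary J₁` and on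
`ContractibleSpace W₁ ∧ ContractibleSpace W₂`, repacking the 21-component witness and passing the
acyclicity hypothesis `hacyc` on to the planar sector. PROVABLE NOW: the 12-line script of
Theorems/ConvexBisectionAcyclicRigidityBySectors.lean (p87624, accepted) with `hacyc` added to the
planar anonymous constructor (`exact hP M e ⟨W₁, _, _, _, _, W₂, _, _, _, _, J₁, J₂, e₁, e₂, h₁, h₂,
hcov, hs₁, hs₂, hξ, hacyc, hp⟩`); kernel-checked in the planner's Sketch.lean (rc 0, axioms propext
/ Classical.choice / Quot.sound; candidate attached as evidence). Supersedes
AcyclicRigidityBySectors (stmt-SmoothPoincare4-14770, proved p87624, which routes through the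
vestigial support PlanarBisectionRigidity): THIS → AcyclicRigidityBySectors in one line (PlanarBi -/
@[route_item "route-SmoothPoincare4-ConvexBisection"]
def AcyclicRigidityBySectorsPA : Prop :=
  PlanarAcyclicBisectionRigidity → ContractibleTwistedDoubleStandard → ResidualAcyclicBisectionRigidity → AcyclicBisectionRigidity

/-- `AcyclicRigidityBySectorsPA` holds: proved by `Summit.SmoothPoincare4.SmoothPoincare4.Theorems.convexBisection_acyclicRigidityBySectorsPA`. -/
theorem AcyclicRigidityBySectorsPA_holds : AcyclicRigidityBySectorsPA := _root_.Summit.SmoothPoincare4.SmoothPoincare4.Theorems.convexBisection_acyclicRigidityBySectorsPA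

/-- item stmt-SmoothPoincare4-15088 · support · rank 9 · open · by planner
sources: arXiv:1907.06025, arXiv:1607.07661, arXiv:math/0404267
[support] PLANAR-ACYCLIC EXISTENCE (route-choice repair 2026-08-16; the Etnyre-free form of the ROLE
of PlanarBisectionExists stmt-SmoothPoincare4-10512): every Hausdorff second-countable C^∞ M ≃ₕ S⁴
admits a Stein bisection along a common contact seam whose halves are ℚ-acyclic in positive degrees
— verbatim the body of AcyclicBisectionExists — AND whose J₁-induced boundary contact structure is
supported by a planar open book. Relations (pure logic, kernel-checked in the planner's Sketch.lean,
rc 0): THIS → AcyclicBisectionExists (drop the last conjunct); THIS → PlanarAcyclicBisectionRigidity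
→ SmoothPoincare4 (the Etnyre-free PLANAR DECIDING PAIR — the same two lines as the route's
`closes`; the landed smoothPoincare4_of_planar_pair : PlanarBisectionExists →
PlanarBisectionRigidity → SmoothPoincare4 of
Theorems/ConvexBisectionPlanarBisectionExistsPlanarPair.lean is its pre-repair form and should be
restated over the two PA decls). By Etnyre 2004 Thm 4.1 + Mayer–Vietoris THIS is equivalent to
PlanarBisectionExists (planar CONNECTED seam), but that equivalence is exactly the XL fact kept out
of the cone (Literature.Geometry.Symplectic.EtnyrePlanarFilling clause (ii)); here the seam -/
@[route_item "route-SmoothPoincare4-ConvexBisection", crux]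
def PlanarAcyclicBisectionExists : Prop :=
  ∀ (M : Type) [TopologicalSpace M] [T2Space M] [SecondCountableTopology M] [ChartedSpace (EuclideanSpace ℝ (Fin 4)) M] [IsManifold (𝓡 4) ∞ M], M ≃ₕ Metric.sphere (0 : EuclideanSpace ℝ (Fin 5)) 1 → ∃ (W₁ : Type) (_ : TopologicalSpace W₁) (_ : ChartedSpace (EuclideanHalfSpace 4) W₁) (_ : IsManifold (𝓡∂ 4) ∞ W₁) (_ : CompactSpace W₁) (W₂ : Type) (_ : TopologicalSpace W₂) (_ : ChartedSpace (EuclideanHalfSpace 4) W₂) (_ : IsManifold (𝓡∂ 4) ∞ W₂) (_ : CompactSpace W₂) (J₁ : Literature.Geometry.Symplectic.SteinStructure W₁) (J₂ : Literature.Geometry.Symplectic.SteinStructure W₂) (e₁ : W₁ → M) (e₂ : W₂ → M), Manifold.IsSmoothEmbedding (𝓡∂ 4) (𝓡 4) ∞ e₁ ∧ Manifold.IsSmoothEmbedding (𝓡∂ 4) (𝓡 4) ∞ e₂ ∧ Set.range e₁ ∪ Set.range e₂ = Set.univ ∧ Set.range e₁ ∩ Set.range e₂ = e₁ '' (𝓡∂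 4).boundary W₁ ∧ Set.range e₁ ∩ Set.range e₂ = e₂ '' (𝓡∂ 4).boundary W₂ ∧ (∀ w₁ w₂, e₁ w₁ = e₂ w₂ → Submodule.map (mfderiv (𝓡∂ 4) (𝓡 4) e₁ w₁).toLinearMap (Literature.Geometry.Symplectic.contactPlane J₁.J w₁) = Submodule.map (mfderiv (𝓡∂ 4) (𝓡 4) e₂ w₂).toLinearMap (Literature.Geometry.Symplectic.contactPlane J₂.J w₂)) ∧ (∀ k, 0 < k → CategoryTheory.Limits.IsZero (Literature.AlgebraicTopology.SingularHomology.singularHomology ℚ ℚ W₁ k) ∧ CategoryTheory.Limits.IsZero (Literature.AlgebraicTopology.SingularHomology.singularHomology ℚ ℚ W₂ k)) ∧ Literature.Geometry.Symplectic.PlanarContactBoundary J₁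

/-- item stmt-SmoothPoincare4-15219 · support · rank 9 · open · by planner
[support] ROUTE-CHOICE REPAIR 2026-08-16 (Perelman): both halves of a bisection of a homotopy
4-sphere with SIMPLY CONNECTED SEAM are CONTRACTIBLE. For every Hausdorff second-countable C^∞
4-manifold M ≃ₕ S⁴ covered by two smoothly embedded compact bordered 4-manifolds e₁(W₁) ∪ e₂(W₂)
meeting exactly along the images of their boundaries (the route's bisection shape, NO Stein data
needed), if the seam range e₁ ∩ range e₂ is simply connected then W₁ and W₂ are contractible. KNOWN,
pure algebraic topology, Perelman-free; proof: SimplyConnectedSpace ⇒ seam nonempty ⇒ both halves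
nonempty with connected nonempty boundary ≅ seam (a closed component would be all of the connected
M); van Kampen in free-product form over a bicollar of the seam (tree:
VanKampen.fundamentalGroupEquivCoprod, SeamBicollar/BoundaryGluingVanKampen) gives π₁(W₁) ∗ π₁(W₂) ≅
π₁(M) = 1, so both halves are simply connected; Mayer–Vietoris in the homology sphere M (H₁=H₂=H₃=0)
gives H₁(W₁)⊕H₁(W₂) ≅ H₁(Γ) = 0 and H₂(Γ) ≅ H₂(W₁)⊕H₂(W₂) with both components H₂(Γ)=H₂(∂Wᵢ) →
H₂(Wᵢ) injective (pair sequence + Lefschetz H₃(Wᵢ,∂Wᵢ) ≅ H¹(Wᵢ) = 0), forcing H₂(Γ) = 0 = H₂(Wᵢ);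
then the tree's PROVED recognition theorem Literature -/
@[route_item "route-SmoothPoincare4-ConvexBisection"]
def ContractibleHalvesOfSimplyConnectedSeam : Prop :=
  ∀ (M : Type) [TopologicalSpace M] [T2Space M] [SecondCountableTopology M] [ChartedSpace (EuclideanSpace ℝ (Fin 4)) M] [IsManifold (𝓡 4) ∞ M], M ≃ₕ Metric.sphere (0 : EuclideanSpace ℝ (Fin 5)) 1 → ∀ (W₁ : Type) [TopologicalSpace W₁] [ChartedSpace (EuclideanHalfSpace 4) W₁] [IsManifold (𝓡∂ 4) ∞ W₁] [CompactSpace W₁] (W₂ : Type) [TopologicalSpace W₂] [ChartedSpace (EuclideanHalfSpace 4) W₂] [IsManifold (𝓡∂ 4) ∞ W₂] [CompactSpace W₂] (e₁ : W₁ → M) (e₂ : W₂ → M), Manifold.IsSmoothEmbedding (𝓡∂ 4) (𝓡 4) ∞ e₁ → Manifold.IsSmoothEmbedding (𝓡∂ 4) (𝓡 4) ∞ e₂ → Set.range e₁ ∪ Set.range e₂ = Set.univ → Set.range e₁ ∩ Set.range e₂ = e₁ '' (𝓡∂ 4).boundary W₁ → Set.range e₁ ∩ Set.range e₂ = e₂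 '' (𝓡∂ 4).boundary W₂ → SimplyConnectedSpace ↥(Set.range e₁ ∩ Set.range e₂) → ContractibleSpace W₁ ∧ ContractibleSpace W₂

-- earlier Assembly (stmt-SmoothPoincare4-3549, replaced 2026-08-16T00:10:38Z -> stmt-SmoothPoincare4-14054): proved by Summit.SmoothPoincare4.SmoothPoincare4.Theorems.Assembly_proof @ 8bb73626ed90 — AcyclicBisectionExists → AcyclicBisectionRigidity → SmoothPoincare4
/-- item stmt-SmoothPoincare4-14054 · assembly · rank 1 · closed · proved by Summit.SmoothPoincare4.SmoothPoincare4.Theorems.convexBisection_assembly_structural (prover) · by planner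
sources: KervaireMilnor1963, arXiv:math/0601396
[assembly] STRUCTURAL form (rev 3, route-repair rglue 2026-08-16): (every Hausdorff second-countable
C^∞ 4-manifold M with M ≃ₕ S⁴ admits a Stein bisection along a common contact seam with rationally
acyclic halves — the body of AcyclicBisectionExists, written out) → (every such M with such a
bisection is diffeomorphic to S⁴ — the body of AcyclicBisectionRigidity, written out) →
SmoothPoincare4. Definitionally equal to `AcyclicBisectionExists → AcyclicBisectionRigidity →
SmoothPoincare4` (rfl; planner Sketch.lean rc 0) and pure logic: `intro hE hR M _ _ _ _ _ e; exact
hR M e (hE M e)`. The route's DECIDING THEOREM is `closes` in this file (same three lines over the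
two crux decls) and does not depend on this item. PROVERS: prove this item in a Theorems file that
imports ONLY `Summits.SmoothPoincare4.Statement` + the Literature modules of this route (pattern:
Theorems/PICAssembly.lean, Theorems/SchoenfliesSplitAssembly.lean), stating the term structurally —
do NOT import `Summits.SmoothPoincare4.SmoothPoincare4.Theses.ConvexBisection` there: the gate links
a closing proof back into this route file (`Assembly_holds := _root_.<thm>` + auto-import of its
module), and a Theses-importing -/
@[route_item "route-SmoothPoincare4-ConvexBisection"]
def Assembly : Prop :=
  (∀ (M : Type) [TopologicalSpace M] [T2Space M] [SecondCountableTopology M] [ChartedSpace (EuclideanSpace ℝ (Fin 4)) M] [IsManifold (𝓡 4) ∞ M], M ≃ₕ Metric.sphere (0 : EuclideanSpace ℝ (Fin 5)) 1 → ∃ (W₁ : Type) (_ : TopologicalSpace W₁) (_ : ChartedSpace (EuclideanHalfSpace 4) W₁) (_ : IsManifold (𝓡∂ 4) ∞ W₁) (_ : CompactSpace W₁) (W₂ : Type) (_ : TopologicalSpace W₂) (_ : ChartedSpace (EuclideanHalfSpace 4) W₂) (_ : IsManifold (𝓡∂ 4) ∞ W₂) (_ : CompactSpace W₂) (J₁ :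 Literature.Geometry.Symplectic.SteinStructure W₁) (J₂ : Literature.Geometry.Symplectic.SteinStructure W₂) (e₁ : W₁ → M) (e₂ : W₂ → M), Manifold.IsSmoothEmbedding (𝓡∂ 4) (𝓡 4) ∞ e₁ ∧ Manifold.IsSmoothEmbedding (𝓡∂ 4) (𝓡 4) ∞ e₂ ∧ Set.range e₁ ∪ Set.range e₂ = Set.univ ∧ Set.range e₁ ∩ Set.range e₂ = e₁ '' (𝓡∂ 4).boundary W₁ ∧ Set.range e₁ ∩ Set.range e₂ = e₂ '' (𝓡∂ 4).boundary W₂ ∧ (∀ w₁ w₂, e₁ w₁ = e₂ w₂ → Submodule.map (mfderiv (𝓡∂ 4) (𝓡 4) e₁ w₁).toLinearMap (Literature.Geometry.Symplectic.contactPlane J₁.J w₁) = Submodule.map (mfderiv (𝓡∂ 4) (𝓡 4) e₂ w₂).toLinearMap (Literature.Geometry.Symplectic.contactPlane J₂.J w₂)) ∧ (∀ k, 0 < k → CategoryTheory.Limits.IsZero (Literature.AlgebraicTopology.SingularHomology.singularHomology ℚ ℚ W₁ k) ∧ CategoryTheory.Limits.IsZero (Literature.AlgebraicTopology.SingularHomology.singularHomology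 ℚ ℚ W₂ k))) → (∀ (M : Type) [TopologicalSpace M] [T2Space M] [SecondCountableTopology M] [ChartedSpace (EuclideanSpace ℝ (Fin 4)) M] [IsManifold (𝓡 4) ∞ M], M ≃ₕ Metric.sphere (0 : EuclideanSpace ℝ (Fin 5)) 1 → (∃ (W₁ : Type) (_ : TopologicalSpace W₁) (_ : ChartedSpace (EuclideanHalfSpace 4) W₁) (_ : IsManifold (𝓡∂ 4) ∞ W₁) (_ : CompactSpace W₁) (W₂ : Type) (_ : TopologicalSpace W₂) (_ : ChartedSpace (EuclideanHalfSpace 4) W₂) (_ : IsManifold (𝓡∂ 4) ∞ W₂) (_ : CompactSpace W₂) (J₁ : Literature.Geometry.Symplectic.SteinStructure W₁) (J₂ : Literature.Geometry.Symplectic.SteinStructure W₂) (e₁ : W₁ → M) (e₂ : W₂ → M), Manifold.IsSmoothEmbedding (𝓡∂ 4) (𝓡 4) ∞ e₁ ∧ Manifold.IsSmoothEmbedding (𝓡∂ 4) (𝓡 4) ∞ e₂ ∧ Set.range e₁ ∪ Set.range e₂ = Set.univ ∧ Set.range e₁ ∩ Set.range e₂ = e₁ '' (𝓡∂ 4).boundary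 W₁ ∧ Set.range e₁ ∩ Set.range e₂ = e₂ '' (𝓡∂ 4).boundary W₂ ∧ (∀ w₁ w₂, e₁ w₁ = e₂ w₂ → Submodule.map (mfderiv (𝓡∂ 4) (𝓡 4) e₁ w₁).toLinearMap (Literature.Geometry.Symplectic.contactPlane J₁.J w₁) = Submodule.map (mfderiv (𝓡∂ 4) (𝓡 4) e₂ w₂).toLinearMap (Literature.Geometry.Symplectic.contactPlane J₂.J w₂)) ∧ (∀ k, 0 < k → CategoryTheory.Limits.IsZero (Literature.AlgebraicTopology.SingularHomology.singularHomology ℚ ℚ W₁ k) ∧ CategoryTheory.Limits.IsZero (Literature.AlgebraicTopology.SingularHomology.singularHomology ℚ ℚ W₂ k))) → Nonempty (M ≃ₘ⟮𝓡 4, 𝓡 4⟯ Metric.sphere (0 : EuclideanSpace ℝ (Fin 5)) 1)) → SmoothPoincare4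

/-- `Assembly` holds: proved by `Summit.SmoothPoincare4.SmoothPoincare4.Theorems.convexBisection_assembly_structural`. -/
theorem Assembly_holds : Assembly := _root_.Summit.SmoothPoincare4.SmoothPoincare4.Theorems.convexBisection_assembly_structural

/-! D-0027 §2.1 — DECIDING THEOREM (planner-authored via `route open/edit --closes-file`; by planner-rrepair-SmoothPoincare4-ConvexBisectio-13e15e3a-0 2026-08-16T06:28:22Z):
its hypotheses are this route's items and its conclusion the sub-problem Statement (glue_lint), and it elaborates with this file. -/

@[closes "route-SmoothPoincare4-ConvexBisection"] theorem closes (hE : AcyclicBisectionExists) (hR : AcyclicBisectionRigidity) :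
    _root_.SmoothPoincare4 := by
  intro M _ _ _ _ _ e
  exact hR M e (hE M e)

end Summit.SmoothPoincare4.SmoothPoincare4.Theses.ConvexBisection
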